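import Literature.AnabelianGeometry.AbsoluteAnabelian.AbsTopII.DecompositionGroups
import HarnessLib

/-!
# [AbsTopII] Prop 1.3 (iv): bridge between the superseded typing `Prop13iv` and the printed
# form `Prop13iv'` (erratum E-L4-9 / finding F-L4t6g5-1)

S. Mochizuki, *Topics in Absolute Anabelian Geometry II* (2013) [AbsTopII], §1, Def 1.2 (ii) p. 10
and Prop 1.3 (iii), (iv) pp. 11–12 (manuscript pagination, lit key `paper:url-585b8d0ad0d9`).

abc-iut-L4-t4's `DPSCData.Prop13iv` (p404475) quantified the conjugate of `D_{v'}`, `I_{v'}` over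
ALL of `Π_H`; print fixes `Π_{v'}` "up to conjugation in `Π_𝔾`" only (Def 1.2 (ii)), and
abc-iut-L4-t6's kernel certificates (`AbsTopII/Prop13ConjugacyScope.lean`) show the `Π_H`-form fails
whenever `ρ_H(H)` moves a vertex.  The repaired statement `DPSCData.Prop13iv'` (conjugating
element `γ ∈ Π_𝔾`) was appended to `DecompositionGroups.lean` (v2).  This proof-only file (no
definitions, no named facts) records the exact relation between the two typings:

* `prop13iv'_of_prop13iv` — the old form implies the printed one (restriction of the quantifier);
* `prop13iv_of_prop13iv'` — conversely, GIVEN that every `Π_H`-conjugate of each verticial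
  subgroup is already a `Π_𝔾`-conjugate of it («`H` acts trivially on the vertices, up to
  `Π_𝔾`-conjugacy»), the printed form gives back the old one; hence `prop13iv_iff_prop13iv'`;
* `exists_mem_PiG_conj_vertSub_eq_of_mem_PiI` — that hypothesis holds at every `g ∈ Π_I` once
  Prop 1.3 (iii) («`I_v ⥲ I`», typed `Prop13iii`: `I_v·Π_𝔾 = Π_I`) holds, since `I_v = Z_{Π_I}(Π_v)`
  fixes `Π_v`; so for IPSC-extensions (`Π_I = Π_H`, i.e. `H = I`) the two typings are EQUIVALENT
  modulo (iii) (`prop13iv_iff_prop13iv'_of_PiI_eq_top`) — which is why no consumer met the defect.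

HONEST FRAMING: [AbsTopII] is a refereed, undisputed paper and its Prop 1.3 (iv) is untouched; only
the cell's first typing was too strong; nothing here bears on [IUTchIII] Cor. 3.12.
-/

noncomputable section

open scoped Pointwise

namespace Literature.AnabelianGeometry.AbsoluteAnabelian

universe u

/-! ### Conjugation and normalisers / centralisers -/

section GroupTheory

variable {G : Type u} [Group G]

/-- `g·N(K)·g⁻¹ = N(g·K·g⁻¹)` ("whose normalizer … we shall refer to as the decomposition group":
the decomposition group of a conjugate is the conjugate of the decomposition group).
[cite: MochizukiAbsTopII2013, Def 1.2 (ii) p.10] -/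
private theorem conj_smul_normalizer_eq (g : G) (K : Subgroup G) :
    MulAut.conj g • Subgroup.normalizer (K : Set G) =
      Subgroup.normalizer ((MulAut.conj g • K : Subgroup G) : Set G) := by
  have h1 : ∀ S : Subgroup G, MulAut.conj g • S = S.map (MulAut.conj g).toMonoidHom := fun S => rfl
  rw [h1, h1, Subgroup.map_equiv_normalizer_eq]

/-- `g·Z(K)·g⁻¹ = Z(g·K·g⁻¹)` (the inertia group of a conjugate is the conjugate of the inertia
group). [cite: MochizukiAbsTopII2013, Def 1.2 (ii) p.10] -/
private theorem conj_smul_centralizer_eq (g : G) (K : Subgroup G) :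
    MulAut.conj g • Subgroup.centralizer (K : Set G) =
      Subgroup.centralizer ((MulAut.conj g • K : Subgroup G) : Set G) := by
  ext x
  rw [Subgroup.mem_pointwise_smul_iff_inv_smul_mem, Subgroup.mem_centralizer_iff,
    Subgroup.mem_centralizer_iff]
  constructor
  · intro h m hm
    rw [SetLike.mem_coe, Subgroup.mem_pointwise_smul_iff_inv_smul_mem] at hm
    have e := h _ hm
    rw [← smul_mul', ← smul_mul'] at e
    exact MulAction.injective _ e
  · intro h k hk
    have e := h (MulAut.conj g • k) (Subgroup.smul_mem_pointwise_smul _ _ _ hk)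
    apply MulAction.injective (MulAut.conj g)
    simp only [smul_mul', smul_inv_smul]
    exact e

/-- An element centralising `K` conjugates `K` onto itself.
[cite: MochizukiAbsTopII2013, Def 1.2 (ii) p.10] -/
private theorem conj_smul_eq_self_of_mem_centralizer {i : G} {K : Subgroup G}
    (hi : i ∈ Subgroup.centralizer (K : Set G)) : MulAut.conj i • K = K := by
  have key : ∀ k ∈ K, MulAut.conj i • k = k := fun k hk => by
    rw [MulAut.smul_def, MulAut.conj_apply, ← Subgroup.mem_centralizer_iff.mp hi k hk,
      mul_inv_cancel_right]
  ext x
  rw [Subgroup.mem_smul_pointwise_iff_exists]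
  constructor
  · rintro ⟨k, hk, rfl⟩
    rw [key k hk]
    exact hk
  · intro hx
    exact ⟨x, hx, key x hx⟩

end GroupTheory

namespace DPSCData

variable (X : DPSCData.{u})

/-- If conjugation by `g` and by `γ` agree on `Π_v`, they agree on `D_v = N_{Π_H}(Π_v)`.
[cite: MochizukiAbsTopII2013, Def 1.2 (ii) p.10] -/
theorem conj_smul_Dv_eq_of_vertSub_eq {g γ : X.PiH} {v : X.Vert}
    (h : MulAut.conj g • X.vertSub v = MulAut.conj γ • X.vertSub v) :
    MulAut.conj g • X.Dv v = MulAut.conj γ • X.Dv v := by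
  unfold DPSCData.Dv
  rw [conj_smul_normalizer_eq, conj_smul_normalizer_eq, h]

/-- If conjugation by `g` and by `γ` agree on `Π_v`, they agree on `I_v = Z_{Π_I}(Π_v)` (`Π_I`
being normal in `Π_H`). [cite: MochizukiAbsTopII2013, Def 1.2 (ii) p.10] -/
theorem conj_smul_Iv_eq_of_vertSub_eq {g γ : X.PiH} {v : X.Vert}
    (h : MulAut.conj g • X.vertSub v = MulAut.conj γ • X.vertSub v) :
    MulAut.conj g • X.Iv v = MulAut.conj γ • X.Iv v := by
  haveI : X.PiI.Normal := X.normal_PiI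
  unfold DPSCData.Iv
  rw [Subgroup.smul_inf, Subgroup.smul_inf, conj_smul_centralizer_eq, conj_smul_centralizer_eq, h,
    Subgroup.Normal.conj_smul_eq_self g X.PiI, Subgroup.Normal.conj_smul_eq_self γ X.PiI]

/-- The superseded typing `Prop13iv` (conjugating element over `Π_H`) implies the printed form
`Prop13iv'` (conjugating element in `Π_𝔾 ⊆ Π_H`). [cite: MochizukiAbsTopII2013, Prop 1.3 (iv) p.11] -/
theorem prop13iv'_of_prop13iv (h : X.Prop13iv) : X.Prop13iv' :=
  ⟨fun v v' γ _ hne => h.1 v v' γ hne, fun v v' γ _ hne => h.2 v v' γ hne⟩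

/-- Conversely: if every `Π_H`-conjugate of each verticial subgroup `Π_v` is already a `Π_𝔾`-conjugate
of `Π_v` («`H` acts trivially on the vertices of `𝔾`, up to `Π_𝔾`-conjugacy»), then the printed form
`Prop13iv'` gives back the `Π_H`-quantified typing `Prop13iv`.
[cite: MochizukiAbsTopII2013, Prop 1.3 (iv) p.11] -/
theorem prop13iv_of_prop13iv'
    (hfix : ∀ (g : X.PiH) (v : X.Vert), ∃ γ ∈ X.PiG,
      MulAut.conj g • X.vertSub v = MulAut.conj γ • X.vertSub v)
    (h : X.Prop13iv') : X.Prop13iv := by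
  refine ⟨fun v v' g hne => ?_, fun v v' g hne => ?_⟩
  · obtain ⟨γ, hγ, hγeq⟩ := hfix g v'
    rw [X.conj_smul_Dv_eq_of_vertSub_eq hγeq] at hne
    exact h.1 v v' γ hγ hne
  · obtain ⟨γ, hγ, hγeq⟩ := hfix g v'
    rw [X.conj_smul_Iv_eq_of_vertSub_eq hγeq] at hne
    exact h.2 v v' γ hγ hne

/-- Under «`H` acts trivially on the vertices up to `Π_𝔾`-conjugacy» the two typings of Prop 1.3 (iv)
are equivalent. [cite: MochizukiAbsTopII2013, Prop 1.3 (iv) p.11] -/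
theorem prop13iv_iff_prop13iv'
    (hfix : ∀ (g : X.PiH) (v : X.Vert), ∃ γ ∈ X.PiG,
      MulAut.conj g • X.vertSub v = MulAut.conj γ • X.vertSub v) :
    X.Prop13iv ↔ X.Prop13iv' :=
  ⟨X.prop13iv'_of_prop13iv, X.prop13iv_of_prop13iv' hfix⟩

/-- GIVEN Prop 1.3 (iii) (typed `Prop13iii`: `I_v ∩ Π_𝔾 = 1`, `I_v·Π_𝔾 = Π_I`), every element of
`Π_I` conjugates each `Π_v` onto a `Π_𝔾`-conjugate of `Π_v`: write `g = γ·i` with `γ ∈ Π_𝔾`,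
`i ∈ I_v = Z_{Π_I}(Π_v)`, and note that `i` fixes `Π_v`.  (So the inertia part of `H` never moves a
vertex; only `ρ_H(H) ⊄ ρ_I(I)` can.) [cite: MochizukiAbsTopII2013, Prop 1.3 (iii) p.11] -/
theorem exists_mem_PiG_conj_vertSub_eq_of_mem_PiI (h3 : X.Prop13iii) {g : X.PiH}
    (hg : g ∈ X.PiI) (v : X.Vert) :
    ∃ γ ∈ X.PiG, MulAut.conj g • X.vertSub v = MulAut.conj γ • X.vertSub v := by
  haveI : X.PiG.Normal := X.normal_PiG
  have hsup : X.Iv v ⊔ X.PiG = X.PiI := (h3 v).2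
  have hg' : g ∈ ((X.Iv v ⊔ X.PiG : Subgroup X.PiH) : Set X.PiH) := by
    rw [hsup]; exact hg
  rw [Subgroup.mul_normal] at hg'
  obtain ⟨i, hi, γ, hγ, rfl⟩ := Set.mem_mul.mp hg'
  -- `i·γ = (i·γ·i⁻¹)·i` with `i·γ·i⁻¹ ∈ Π_𝔾`
  refine ⟨i * γ * i⁻¹, Subgroup.Normal.conj_mem inferInstance γ hγ i, ?_⟩
  have hiZ : i ∈ Subgroup.centralizer (X.vertSub v : Set X.PiH) := (Subgroup.mem_inf.mp hi).1
  have hfix : MulAut.conj i⁻¹ • X.vertSub v = X.vertSub v :=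
    conj_smul_eq_self_of_mem_centralizer (inv_mem hiZ)
  have key : MulAut.conj (i * γ * i⁻¹) • X.vertSub v = MulAut.conj (i * γ) • X.vertSub v := by
    rw [show MulAut.conj (i * γ * i⁻¹) = MulAut.conj (i * γ) * MulAut.conj i⁻¹ from map_mul _ _ _,
      mul_smul, hfix]
  exact key.symm

/-- For an IPSC-extension (`Π_I = Π_H`, i.e. `H = I`) satisfying Prop 1.3 (iii), the superseded typing
`Prop13iv` and the printed form `Prop13iv'` are EQUIVALENT — the inertia group never moves a vertex.
[cite: MochizukiAbsTopII2013, Prop 1.3 (iv) p.11] -/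
theorem prop13iv_iff_prop13iv'_of_PiI_eq_top (h3 : X.Prop13iii) (htop : X.PiI = ⊤) :
    X.Prop13iv ↔ X.Prop13iv' :=
  X.prop13iv_iff_prop13iv' fun g v =>
    X.exists_mem_PiG_conj_vertSub_eq_of_mem_PiI h3 (htop ▸ Subgroup.mem_top g) v

end DPSCData

end Literature.AnabelianGeometry.AbsoluteAnabelian

end
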